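import Literature.AlgebraicGeometry.Motives.SurfaceNet
import Literature.AlgebraicGeometry.Motives.ComplexPointsEhresmann
import Literature.AlgebraicGeometry.Motives.ComplexPointsManifold
import Literature.AlgebraicGeometry.HodgeTheory.ComplexGysin
import Literature.AlgebraicGeometry.HodgeTheory.GysinBaseChangeOfKunneth
import Literature.AlgebraicGeometry.HodgeTheory.HodgeTypePullback
import Literature.NumberTheory.Transcendental.Analytification
import Literature.NumberTheory.Transcendental.AnalytificationConnected
import Summits.HodgeConjecture.HodgeConjecture.Theorems.CurveNetMordellWeilCurveNetExistsLocalDegree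
import HarnessLib

/-!
# The cohomological transfer along a birational morphism of smooth projective `n`-folds which is
an isomorphism over a non-empty open subset: `σ_* σ^* = t • id`, `t ≠ 0`

Helper file for the support item `CurveNetExists` (stmt-HodgeConjecture-2788) of route
`Summits/HodgeConjecture/HodgeConjecture/Theses/CurveNetMordellWeil`; the GENERAL form of the
statements of `CurveNetMordellWeilCurveNetExistsTransfer` (which treats the blow-down of a
`Motives.CurveNet`). Data: smooth projective complex varieties `X̃`, `X` of the same dimension `n`,
a `ℂ`-morphism `σ : X̃ ⟶ X` and a NON-EMPTY open `U ⊆ X` over which `σ` restricts to an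
isomorphism `σ⁻¹U ⥲ U` (`[IsIso (σ.left ∣_ U)]`) — e.g. the blow-down of a curve net, of a net of
`r`-folds (`Motives.FiberNet r m X`, in particular surface nets), or any blow-up. For every
orientation family `μ`, ALL PROVED:

* `exists_homeomorph_of_isIso_morphismRestrict` — `σ(ℂ)` restricts to a homeomorphism between the
  non-empty open subset `σ⁻¹U(ℂ) ⊆ X̃(ℂ)` and the open subset `U(ℂ) ⊆ X(ℂ)` (open immersions give
  open embeddings of complex points, SGA1 XII Prop. 3.1 (xi), the tree's
  `isOpenEmbedding_map_holds`), and identifies no point of `σ⁻¹U(ℂ)` with another point of `X̃(ℂ)`;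
* `map_fundamentalClass_ne_zero_of_isIso_morphismRestrict` — `σ(ℂ)_* [X̃(ℂ)]_μ ≠ 0` in
  `H_{2n}(X(ℂ); ℂ)` (local degree at a point with one-point fibre, Hatcher Thm. 3.26 /
  Prop. 2.30: the topological helper `map_fundamentalClass_ne_zero_of_homeomorph_nhds`);
* `complexGysin_one_ne_zero_of_isIso_morphismRestrict`,
  `exists_complexGysin_map_eq_smul_of_isIso_morphismRestrict` — `σ_* 1 ≠ 0`, so `σ_* 1 = t • 1`
  with `t ≠ 0` (`H⁰(X(ℂ); ℂ) = ℂ • 1`), and `σ_* (σ^* c) = c ∪ σ_* 1 = t • c` for every class `c`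
  (projection formula, Fulton, *Young Tableaux*, App. B (6), the tree's `complexGysin_cup`) — the
  topological content of "`σ_* σ^* = deg σ • id`, `deg σ = 1` for `σ` birational";
* `span_hodgeClasses_le_map_complexGysin_of_isIso_morphismRestrict` — given a Hodge model of `X̃`,
  the `ℂ`-span of the rational `(q,q)`-classes of `X` lies in `σ_*` of the `ℂ`-span of the rational
  `(q,q)`-classes of `X̃` (`c = σ_* (t⁻¹ • σ^* c)`; `σ^* c` is rational of type `(q,q)`, Voisin I
  §7.3.2, the tree's `IsOfHodgeType.map_of_le`);
* the corollaries for nets of `r`-folds `N : Motives.FiberNet r m X` (`σ = N.blowDown`, `U = X ∖ F`):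
  `FiberNet.exists_complexGysin_blowDown_map_eq_smul`,
  `FiberNet.span_hodgeClasses_le_map_complexGysin_blowDown`.

## References

* [FultonYoungTableaux1997] W. Fulton, Young Tableaux, CUP 1997, App. B §B.1 (5)–(6).
* [HatcherAT2002] A. Hatcher, Algebraic Topology, CUP 2002, §2.2 Prop. 2.30, §3.3 Thm. 3.26.
* [VoisinHodgeI2002] C. Voisin, Hodge Theory and Complex Algebraic Geometry I, CUP 2002, §7.3.2.
* [SGA1] A. Grothendieck, M. Raynaud, SGA 1, Exp. XII Prop. 3.1 (xi).
-/

noncomputable section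

open CategoryTheory AlgebraicGeometry Set Topology
open Literature.AlgebraicGeometry Literature.AlgebraicGeometry.Motives
open Literature.AlgebraicGeometry.HodgeTheory
open Literature.AlgebraicTopology.SingularHomology

-- `Summit.HodgeConjecture.HodgeConjecture.Theorems` is the mandated namespace (single-conjunct summit:
-- Sub = Summit), which `linter.dupNamespace` flags on every declaration; the lakefile turns the
-- linter off tree-wide (weak option), restated here so stand-alone elaboration is warning-free too.
set_option linter.dupNamespace false

namespace Summit.HodgeConjecture.HodgeConjecture.Theorems

variable {n : ℕ} {Xt X : SchemeOver ℂ}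

/-! ### A morphism which is an isomorphism over an open subset is a homeomorphism of complex points there -/

/-- **Over `U`, a morphism inducing `σ⁻¹U ⥲ U` is a homeomorphism of complex points.** For a
`ℂ`-morphism `σ : X̃ ⟶ X` (`X̃` smooth over `ℂ`) and a non-empty open `U ⊆ X` with `σ ∣_ U` an
isomorphism, there are open subsets `V ⊆ X̃(ℂ)` (the complex points over `σ⁻¹U`, non-empty) and
`W ⊆ X(ℂ)` (the complex points over `U`) and a homeomorphism `e : V ≃ₜ W` which is the restriction
of `σ(ℂ)`, and `σ(ℂ)` does not identify a point of `V` with any other point of `X̃(ℂ)` (open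
immersions induce open embeddings of complex points, SGA1 XII Prop. 3.1 (xi)).
[cite: SGA1, Exp. XII Prop. 3.1 (xi)] -/
theorem exists_homeomorph_of_isIso_morphismRestrict [Smooth Xt.hom] (σ : Xt ⟶ X)
    (U : X.left.Opens) (hU : (U : Set X.left).Nonempty) [IsIso (σ.left ∣_ U)] :
    ∃ (V : Set (ComplexPoints Xt)) (W : Set (ComplexPoints X)) (e : V ≃ₜ W),
      IsOpen V ∧ IsOpen W ∧ V.Nonempty ∧
      (∀ v : V, ((e v : W) : ComplexPoints X) = AlgPoints.map σ (v : ComplexPoints Xt)) ∧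
      ∀ (v : V) (P : ComplexPoints Xt),
        AlgPoints.map σ P = AlgPoints.map σ (v : ComplexPoints Xt) → P = (v : ComplexPoints Xt) := by
  -- the open pieces `U ⊆ X` and `Ũ = σ⁻¹ U ⊆ X̃` as `ℂ`-schemes, the open immersions
  let XU : SchemeOver ℂ := openSubschemeOver X U
  let XUt : SchemeOver ℂ := openSubschemeOver Xt (σ.left ⁻¹ᵁ U)
  obtain ⟨ιU, hιU⟩ : ∃ ι : XU ⟶ X, ι.left = U.ι := ⟨openSubschemeOverι X _, rfl⟩
  obtain ⟨ιUt, hιUt⟩ : ∃ ι : XUt ⟶ Xt, ι.left = (σ.left ⁻¹ᵁ U).ι := ⟨openSubschemeOverι Xt _, rfl⟩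
  haveI : IsOpenImmersion ιU.left := by
    rw [hιU]; exact (inferInstance : IsOpenImmersion U.ι)
  haveI : IsOpenImmersion ιUt.left := by
    rw [hιUt]; exact (inferInstance : IsOpenImmersion (σ.left ⁻¹ᵁ U).ι)
  -- the scheme isomorphism `σ ∣_ U : Ũ ⥲ U` and its inverse, over `ℂ`
  obtain ⟨σU, hσU⟩ : ∃ φ : XUt ⟶ XU, φ.left = σ.left ∣_ U :=
    ⟨Over.homMk (σ.left ∣_ U) (by
      change (σ.left ∣_ U) ≫ U.ι ≫ X.hom = (σ.left ⁻¹ᵁ U).ι ≫ Xt.hom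
      rw [← Category.assoc, morphismRestrict_ι, Category.assoc, Over.w σ]), rfl⟩
  obtain ⟨τU, hτU⟩ : ∃ φ : XU ⟶ XUt, φ.left = inv (σ.left ∣_ U) :=
    ⟨Over.homMk (show ((U : X.left.Opens) : Scheme) ⟶ ((σ.left ⁻¹ᵁ U : Xt.left.Opens) : Scheme) from
        inv (σ.left ∣_ U)) (by
      change inv (σ.left ∣_ U) ≫ (σ.left ⁻¹ᵁ U).ι ≫ Xt.hom = U.ι ≫ X.hom
      rw [IsIso.inv_comp_eq, ← Category.assoc, morphismRestrict_ι, Category.assoc, Over.w σ]), rfl⟩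
  have hστ : σU ≫ τU = 𝟙 XUt := by
    ext : 1
    rw [Over.comp_left, hσU, hτU, Over.id_left]
    exact IsIso.hom_inv_id (σ.left ∣_ U)
  have hτσ : τU ≫ σU = 𝟙 XU := by
    ext : 1
    rw [Over.comp_left, hσU, hτU, Over.id_left]
    exact IsIso.inv_hom_id (σ.left ∣_ U)
  have heU : σU ≫ ιU = ιUt ≫ σ := by
    ext : 1
    rw [Over.comp_left, Over.comp_left, hσU, hιU, hιUt]
    exact morphismRestrict_ι σ.left U
  -- complex points: the homeomorphism `XUt(ℂ) ≃ₜ XU(ℂ)`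
  let e₀ : ComplexPoints XUt ≃ₜ ComplexPoints XU :=
    { toFun := AlgPoints.map σU
      invFun := AlgPoints.map τU
      left_inv := fun P ↦ by
        rw [← AlgPoints.map_comp_apply, hστ, AlgPoints.map_id_apply]
      right_inv := fun Q ↦ by
        rw [← AlgPoints.map_comp_apply, hτσ, AlgPoints.map_id_apply]
      continuous_toFun := AlgPoints.continuous_map σU
      continuous_invFun := AlgPoints.continuous_map τU }
  have he₀ : ∀ P, e₀ P = AlgPoints.map σU P := fun P ↦ rfl
  -- the open embeddings `XUt(ℂ) ↪ X̃(ℂ)`, `XU(ℂ) ↪ X(ℂ)` and their ranges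
  have hembt : IsEmbedding (AlgPoints.map ιUt : ComplexPoints XUt → ComplexPoints Xt) :=
    AlgPoints.isEmbedding_map ιUt
  have hemb : IsEmbedding (AlgPoints.map ιU : ComplexPoints XU → ComplexPoints X) :=
    AlgPoints.isEmbedding_map ιU
  have hVt : Set.range (AlgPoints.map ιUt : ComplexPoints XUt → ComplexPoints Xt) =
      {P | P.pt ∈ σ.left ⁻¹ᵁ U} := by
    rw [AlgPoints.range_map_of_isOpenImmersion_holds ιUt]
    ext P
    change P.pt ∈ Set.range ιUt.left ↔ P.pt ∈ σ.left ⁻¹ᵁ U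
    rw [hιUt]
    exact Set.ext_iff.1 (Scheme.Opens.range_ι (σ.left ⁻¹ᵁ U)) P.pt
  refine ⟨Set.range (AlgPoints.map ιUt), Set.range (AlgPoints.map ιU),
    (hembt.toHomeomorph.symm.trans e₀).trans hemb.toHomeomorph,
    AlgPoints.isOpen_range_map ιUt, AlgPoints.isOpen_range_map ιU, ?_, ?_, ?_⟩
  · -- `σ⁻¹U` has a complex point: it is a non-empty (`≅ U`) open subscheme of `X̃`
    obtain ⟨u, hu⟩ := hU
    have hne : ((σ.left ⁻¹ᵁ U : Xt.left.Opens) : Set Xt.left).Nonempty :=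
      ⟨((inv (σ.left ∣_ U)).base ⟨u, hu⟩ : (σ.left ⁻¹ᵁ U : Xt.left.Opens)).1,
        ((inv (σ.left ∣_ U)).base ⟨u, hu⟩).2⟩
    haveI : LocallyOfFiniteType Xt.hom := inferInstance
    obtain ⟨P, hP⟩ := ComplexPoints.exists_pt_mem (X := Xt) hne (σ.left ⁻¹ᵁ U).isOpen.isLocallyClosed
    refine ⟨P, ?_⟩
    rw [hVt]
    exact hP
  · -- `e` is the restriction of `σ(ℂ)`
    rintro ⟨v, hv⟩
    obtain ⟨p, rfl⟩ := hv
    have h1 : hembt.toHomeomorph.symm ⟨AlgPoints.map ιUt p, ⟨p, rfl⟩⟩ = p := by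
      rw [Homeomorph.symm_apply_eq]
      ext : 1
      rfl
    change (AlgPoints.map ιU (e₀ (hembt.toHomeomorph.symm ⟨AlgPoints.map ιUt p, ⟨p, rfl⟩⟩)) :
      ComplexPoints X) = AlgPoints.map σ (AlgPoints.map ιUt p)
    rw [h1, he₀, ← AlgPoints.map_comp_apply, heU, AlgPoints.map_comp_apply]
  · -- `σ(ℂ)` does not identify a point over `σ⁻¹U` with another point
    rintro ⟨v, hv⟩ P hP
    obtain ⟨p, rfl⟩ := hv
    have hPt : P.pt ∈ σ.left ⁻¹ᵁ U := by
      have h1 : (AlgPoints.map σ P).pt = (AlgPoints.map σ (AlgPoints.map ιUt p)).pt := by rw [hP]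
      rw [AlgPoints.pt_map, AlgPoints.pt_map] at h1
      have h2 : (AlgPoints.map ιUt p).pt ∈ σ.left ⁻¹ᵁ U := by
        have h3 : AlgPoints.map ιUt p ∈ Set.range (AlgPoints.map ιUt) := ⟨p, rfl⟩
        rw [hVt] at h3
        exact h3
      change σ.left.base P.pt ∈ (U : Set X.left)
      change σ.left.base (AlgPoints.map ιUt p).pt ∈ (U : Set X.left) at h2
      change σ.left.base P.pt = σ.left.base (AlgPoints.map ιUt p).pt at h1
      rw [h1]
      exact h2
    have hPV : P ∈ Set.range (AlgPoints.map ιUt : ComplexPoints XUt → ComplexPoints Xt) := by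
      rw [hVt]; exact hPt
    obtain ⟨p', rfl⟩ := hPV
    rw [← AlgPoints.map_comp_apply, ← AlgPoints.map_comp_apply, ← heU, AlgPoints.map_comp_apply,
      AlgPoints.map_comp_apply] at hP
    have h3 : AlgPoints.map σU p' = AlgPoints.map σU p := hemb.injective hP
    have h4 : p' = p := e₀.injective h3
    rw [h4]

/-! ### The degree of `σ` is not zero -/

/-- **`σ(ℂ)_* [X̃(ℂ)]_μ ≠ 0` in `H_{2n}(X(ℂ); ℂ)`** for a `ℂ`-morphism `σ : X̃ ⟶ X` of smooth
projective `n`-folds which is an isomorphism over a non-empty open `U ⊆ X`, and any orientation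
family `μ`: `σ(ℂ)` is a homeomorphism near a point over `U` with one-point fibre
(`exists_homeomorph_of_isIso_morphismRestrict`), so the topological helper
`map_fundamentalClass_ne_zero_of_homeomorph_nhds` applies to the closed `2n`-manifold `X̃(ℂ)`.
[cite: HatcherAT2002, §3.3 Thm. 3.26(a) and §2.2 Prop. 2.30] -/
theorem map_fundamentalClass_ne_zero_of_isIso_morphismRestrict (hXt : IsSmoothProjective n Xt)
    (hX : IsSmoothProjective n X) (σ : Xt ⟶ X) (U : X.left.Opens) (hU : (U : Set X.left).Nonempty)
    [IsIso (σ.left ∣_ U)] (μ : OrientationFamily) :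
    singularHomology.map ℂ ℂ (AlgPoints.mapContinuous (L := ℂ) σ) (2 * n)
      (μ hXt).fundamentalClass ≠ 0 := by
  haveI : Smooth Xt.hom :=
    haveI := hXt.smoothOfRelativeDimension
    SmoothOfRelativeDimension.smooth n Xt.hom
  obtain ⟨V, W, e, hV, hW, ⟨x, hx⟩, he, hinj⟩ := exists_homeomorph_of_isIso_morphismRestrict σ U hU
  letI := hXt.chartedSpace
  haveI := ComplexPoints.compactSpace_of_isSmoothProjective hXt
  haveI := ComplexPoints.t2Space_of_isSmoothProjective hXt
  haveI := ComplexPoints.t2Space_of_isSmoothProjective hX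
  have hf : Set.MapsTo (AlgPoints.mapContinuous (L := ℂ) σ) ({x}ᶜ : Set (ComplexPoints Xt))
      ({AlgPoints.mapContinuous (L := ℂ) σ x}ᶜ : Set (ComplexPoints X)) := by
    intro P hP h
    exact hP (hinj ⟨x, hx⟩ P h)
  exact map_fundamentalClass_ne_zero_of_homeomorph_nhds ℂ (μ hXt)
    (AlgPoints.mapContinuous (L := ℂ) σ) hV hW e he hx hf

/-- **`σ_* 1 ≠ 0` in `H⁰(X(ℂ); ℂ)`** (`σ_* 1 ⌢ [X(ℂ)] = σ(ℂ)_* [X̃(ℂ)]`, Fulton App. B (5), the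
tree's `capProduct_complexGysin_one`). [cite: FultonYoungTableaux1997, Appendix B §B.1 (5)] -/
theorem complexGysin_one_ne_zero_of_isIso_morphismRestrict {μ : OrientationFamily}
    (hμ : μ.HasPoincareDuality) (hXt : IsSmoothProjective n Xt) (hX : IsSmoothProjective n X)
    (σ : Xt ⟶ X) (U : X.left.Opens) (hU : (U : Set X.left).Nonempty) [IsIso (σ.left ∣_ U)] :
    complexGysin μ hXt hX σ (rfl : 0 + 2 * n = 0 + 2 * n)
      (singularCohomology.one ℂ (ComplexPoints Xt)) ≠ 0 := by
  intro h0
  apply map_fundamentalClass_ne_zero_of_isIso_morphismRestrict hXt hX σ U hU μ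
  have hcap := capProduct_complexGysin_one hμ hXt hX σ (e := 0) rfl
  rw [← hcap]
  have h0' : complexGysin μ hXt hX σ (show 0 + 2 * n = 2 * 0 + 2 * n by omega)
      (singularCohomology.one ℂ (ComplexPoints Xt)) = 0 := h0
  rw [h0', LinearMap.map_zero, LinearMap.zero_apply]

/-- **`σ_* σ^* = t • id` with `t ≠ 0`** on `H*(X(ℂ); ℂ)` for a morphism `σ : X̃ ⟶ X` of smooth
projective `n`-folds which is an isomorphism over a non-empty open subset (the topological content
of "`σ_* σ^* = deg σ · id` with `deg σ = 1` for `σ` birational"): `σ_* 1 = t • 1`, `t ≠ 0`, and the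
projection formula `σ_* (σ^* c ∪ 1) = c ∪ σ_* 1` (Fulton App. B (6), `complexGysin_cup`).
[cite: FultonYoungTableaux1997, Appendix B §B.1 (6)] -/
theorem exists_complexGysin_map_eq_smul_of_isIso_morphismRestrict {μ : OrientationFamily}
    (hμ : μ.HasPoincareDuality) (hXt : IsSmoothProjective n Xt) (hX : IsSmoothProjective n X)
    (σ : Xt ⟶ X) (U : X.left.Opens) (hU : (U : Set X.left).Nonempty) [IsIso (σ.left ∣_ U)] :
    ∃ t : ℂ, t ≠ 0 ∧ ∀ (k : ℕ) (c : complexBetti X k),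
      complexGysin μ hXt hX σ (rfl : k + 2 * n = k + 2 * n) (complexBetti.map σ k c) = t • c := by
  obtain ⟨t, ht⟩ := exists_eq_smul_one μ hX (complexGysin μ hXt hX σ
    (rfl : 0 + 2 * n = 0 + 2 * n) (singularCohomology.one ℂ (ComplexPoints Xt)))
  refine ⟨t, ?_, fun k c ↦ ?_⟩
  · rintro rfl
    rw [zero_smul] at ht
    exact complexGysin_one_ne_zero_of_isIso_morphismRestrict hμ hXt hX σ U hU ht
  · have hcup := complexGysin_cup hμ hXt hX σ (Nat.add_zero k) (rfl : k + 2 * n = k + 2 * n)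
      (rfl : 0 + 2 * n = 0 + 2 * n) (Nat.add_zero k) c (singularCohomology.one ℂ (ComplexPoints Xt))
    rw [cupProduct_one] at hcup
    rw [hcup, ht, LinearMap.map_smul, cupProduct_one]

/-! ### Hodge classes of `X` are `σ_*` of Hodge classes of `X̃` -/

/-- **Hodge classes transfer along `σ`.** For a morphism `σ : X̃ ⟶ X` of smooth projective
`n`-folds which is an isomorphism over a non-empty open subset, an orientation family `μ` with
Poincaré duality and a Hodge model of `X̃`, the `ℂ`-span of the rational `(q,q)`-classes of `X`
lies in `σ_*` of the `ℂ`-span of the rational `(q,q)`-classes of `X̃`: `c = σ_* (t⁻¹ • σ^* c)` and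
`σ^* c` is rational (`IsRationalClass.pullback`) of Hodge type `(q,q)` (Voisin I §7.3.2, the tree's
`IsOfHodgeType.map_of_le`). [cite: VoisinHodgeI2002, §7.3.2] [cite: FultonYoungTableaux1997, Appendix B §B.1 (6)] -/
theorem span_hodgeClasses_le_map_complexGysin_of_isIso_morphismRestrict {μ : OrientationFamily}
    (hμ : μ.HasPoincareDuality) (hXt : IsSmoothProjective n Xt) (hX : IsSmoothProjective n X)
    (σ : Xt ⟶ X) (U : X.left.Opens) (hU : (U : Set X.left).Nonempty) [IsIso (σ.left ∣_ U)]
    (B : HodgeModel n Xt) (q : ℕ) :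
    Submodule.span ℂ {c : complexBetti X (2 * q) |
        IsRationalClass c ∧ IsOfHodgeType n X (2 * q) q q c} ≤
      (Submodule.span ℂ {c : complexBetti Xt (2 * q) |
          IsRationalClass c ∧ IsOfHodgeType n Xt (2 * q) q q c}).map
        (complexGysin μ hXt hX σ rfl) := by
  obtain ⟨t, ht, htc⟩ := exists_complexGysin_map_eq_smul_of_isIso_morphismRestrict hμ hXt hX σ U hU
  refine Submodule.span_le.2 ?_
  rintro c ⟨hc, hh⟩
  refine ⟨t⁻¹ • complexBetti.map σ (2 * q) c, ?_, ?_⟩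
  · exact Submodule.smul_mem _ _ (Submodule.subset_span
      ⟨hc.pullback _, hh.map_of_le hXt hX B σ le_rfl⟩)
  · rw [LinearMap.map_smul, htc, smul_smul, inv_mul_cancel₀ ht, one_smul]

/-! ### Corollaries for nets of `r`-folds (`Motives.FiberNet`, e.g. surface nets) -/

/-- **`σ_* σ^* = t • id`, `t ≠ 0`, for the blow-down of a net of `r`-folds** `N : FiberNet r m X`
on a smooth projective `X` of dimension `m + r` (`σ = N.blowDown` is an isomorphism over the
non-empty open `X ∖ F`, fields `isIso_blowDown_restrict`, `baseLocus_ne_univ`).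
[cite: FultonYoungTableaux1997, Appendix B §B.1 (6)] -/
theorem FiberNet.exists_complexGysin_blowDown_map_eq_smul {μ : OrientationFamily}
    (hμ : μ.HasPoincareDuality) {r m : ℕ} (N : FiberNet r m X) (hX : IsSmoothProjective (m + r) X) :
    ∃ t : ℂ, t ≠ 0 ∧ ∀ (k : ℕ) (c : complexBetti X k),
      complexGysin μ N.isSmoothProjective_total hX N.blowDown
        (rfl : k + 2 * (m + r) = k + 2 * (m + r)) (complexBetti.map N.blowDown k c) = t • c :=
  haveI := N.isIso_blowDown_restrict
  exists_complexGysin_map_eq_smul_of_isIso_morphismRestrict hμ N.isSmoothProjective_total hX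
    N.blowDown N.offBaseLocus N.offBaseLocus_nonempty

/-- **Hodge classes of `X` are `σ_*` of Hodge classes of the total space of a net of `r`-folds**
(given a Hodge model of the total space). [cite: VoisinHodgeI2002, §7.3.2] -/
theorem FiberNet.span_hodgeClasses_le_map_complexGysin_blowDown {μ : OrientationFamily}
    (hμ : μ.HasPoincareDuality) {r m : ℕ} (hX : IsSmoothProjective (m + r) X) (N : FiberNet r m X)
    (B : HodgeModel (m + r) N.total) (q : ℕ) :
    Submodule.span ℂ {c : complexBetti X (2 * q) |
        IsRationalClass c ∧ IsOfHodgeType (m + r) X (2 * q) q q c} ≤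
      (Submodule.span ℂ {c : complexBetti N.total (2 * q) |
          IsRationalClass c ∧ IsOfHodgeType (m + r) N.total (2 * q) q q c}).map
        (complexGysin μ N.isSmoothProjective_total hX N.blowDown rfl) :=
  haveI := N.isIso_blowDown_restrict
  span_hodgeClasses_le_map_complexGysin_of_isIso_morphismRestrict hμ N.isSmoothProjective_total hX
    N.blowDown N.offBaseLocus N.offBaseLocus_nonempty B q

end Summit.HodgeConjecture.HodgeConjecture.Theorems

end
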